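import Summits.AtomisticToContinuum.BoseEinsteinCondensation.Theses.BECStronglyRayleigh
import Summits.AtomisticToContinuum.BoseEinsteinCondensation.Theorems.BECStronglyRayleighLatticeCoherenceAssemblyGroundSpace
import Summits.AtomisticToContinuum.BoseEinsteinCondensation.Theorems.BECStronglyRayleighLatticeCoherenceAssemblyLowerNorm
import Summits.AtomisticToContinuum.BoseEinsteinCondensation.Theorems.BECStronglyRayleighSectorGroundStatePerron
import Summits.AtomisticToContinuum.BoseEinsteinCondensation.Theorems.BECStronglyRayleighPenaltySelectsSector
import Literature.MathematicalPhysics.QuantumLattice.LiebMattisSectorPF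
import Literature.MathematicalPhysics.QuantumLattice.ApproximateEigenvectorLemmas
import Summits.AtomisticToContinuum.BoseEinsteinCondensation.Theorems.BECStronglyRayleighKineticLatticeBECLadderStep
import Summits.AtomisticToContinuum.BoseEinsteinCondensation.Theorems.BECStronglyRayleighKineticLatticeBECProductLowerBound
import Summits.AtomisticToContinuum.BoseEinsteinCondensation.Theorems.BECStronglyRayleighKineticLatticeBECTransfer
import Summits.AtomisticToContinuum.BoseEinsteinCondensation.Theorems.BECStronglyRayleighKineticLatticeBECReduction
import Summits.AtomisticToContinuum.BoseEinsteinCondensation.Theorems.BECStronglyRayleighKineticLatticeBECTwoBodyL2Flat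
import Summits.AtomisticToContinuum.BoseEinsteinCondensation.Theorems.BECStronglyRayleighKineticLatticeBECInsertionInfidelityLow
import HarnessLib

/-!
# Line `Sketch` (sector ladder with coherent insertion) for the crux `KineticLatticeBEC`
# (item stmt-AtomisticToContinuum-9671, route BECStronglyRayleigh) — lead skeleton (lead c1 reshape)

Cards `sector-ladder-coherent-insertion` (+ `dilution-pinned-anchor`), crux-ideate r1 k2; triage r1-1/r1-2
PASS. Notation: `V = L³`, `Ŝ± = Ŝˣ_tot ± iŜʸ_tot`, `ψ_N` a nonzero entrywise-nonnegative ground vector of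
the sector `Ŝᶻ_tot = N − V/2` of `xyTorus 3 L 1` (hard-core bosons; occupied = spin up = index `0`),
`f(N) = ‖Ŝ⁻ψ_N‖²/‖ψ_N‖² = ⟨Ŝ⁺Ŝ⁻⟩_N = V·n₀` (the crux asks `f(N) ≥ c·N·V`, `1 ≤ N ≤ V/2`).

THE LADDER. `‖Ŝ⁺ψ_N‖² = f(N)‖ψ_N‖² + (V − 2N)‖ψ_N‖²` (`[Ŝ⁺,Ŝ⁻] = 2Ŝᶻ`), and by Cauchy–Schwarz
`f(N+1)·‖ψ_N‖² ≥ |⟨ψ_{N+1}, Ŝ⁺ψ_N⟩|²/‖ψ_{N+1}‖²`; so an insertion-FIDELITY bound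
`|⟨ψ_{N+1}, Ŝ⁺ψ_N⟩|² ≥ (1 − δ_N)‖Ŝ⁺ψ_N‖²‖ψ_{N+1}‖²` gives `f(N+1) ≥ (1 − δ_N)(f(N) + V − 2N)`, whence
`f(N) ≥ Π_{i<N}(1 − δ_i) · N(V − N + 1)` (Tóth's value times the fidelity budget), and a summable profile
`δ_N ≤ K/√(V(N+1))` gives `Π ≥ e^{−2√2K}` uniformly in `N ≤ V/2`: lattice BEC with `c = ½e^{−2√2K}`.

Stubs (registered; `KineticLatticeBEC_of` below is sorry-free modulo them and concludes the crux BY NAME).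
Reshape by lead c1 (2026-08-16): the former single stub `stub_insertionInfidelityBound` (all rungs) is
split by rung into its provable dilute end and its crux-sized remainder:
* `stub_insertionInfidelityHigh` — THE HARD STUB (lead): the insertion infidelity between adjacent-sector
  Perron ground vectors is `≤ K/√(V(N+1))` for the rungs `N ≥ 2` (cross-multiplied form). Honest core of
  the line: a summable infidelity budget is a re-coordinatisation of the crux (card §(e)); this is LSSY
  Ch. 11 in variance form (`δ_N = Var_P(h_N)/E_P[h_N²]`, card) — crux-sized.
* `stub_insertionInfidelityLow` — the rungs `N = 0, 1` (vacuum → one particle: fidelity exactly `1`;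
  one → two particles: `δ₁ = Var(g)/E[g²] ≤ 400/L²` for the two-body pair profile `g`), GIVEN the
  two-body `ℓ²`-flatness below. Provable now (translation invariance + Perron uniqueness as in the
  landed `stub_translationInvariance`, explicit action of `Ŝ⁺_tot`, the landed two-body embedding /
  energy bound of crux 9673's `TwoBodyBase`).
* `stub_twoBodyL2Flat` — the two-body `ℓ²`-FLATNESS on `(ℤ/Lℤ)³`: a nonnegative solution `g`, `g(0) = 0`, of
  the punctured resolvent equation `Σ_{y∼v} g(y) + E g(v) = s[v = 0]` with `(deg 0 + E)(L³ − 1) ≤ 6` has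
  `L³ Σ g² ≤ (1 + 400/L²)(Σ g)²` (Plancherel: `L³Σg² = (Σg)² + Σ_{k≠0}|ĝ(k)|²`, `ĝ(k) = s/(Λ_k + E)`,
  `|Λ_k + E| ≥ 4‖m(k)‖_∞²/L²` by one Jordan bound, `Σ_{m≠0}‖m‖_∞⁻⁴ ≤ 108`, `s = (deg 0 + E)·Σg`).
  Provable now (pattern: landed `cb1tb_fourier_eq`, `g3bd_coord`, `g3bd_sum_inv_dispersion_le`).
* LANDED (imported): `stub_ladderStep` (p87720), `stub_productLowerBound` (p88640), `stub_transfer`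
  (p89477), `stub_reduction` (p90479, the line's CONDITIONAL THEOREM: uniformly positive fidelity budget
  `Π_{i<N}(1 − δ(L,i)) ≥ κ > 0` ⟹ the crux with `c = κ/2`).

Disproof constraints honoured (Cruxes/KineticLatticeBEC/Disproof.lean v6): `c = ½e^{−2√2K} ≤ ½`
(`constant_le_half`); the filling cap is used exactly at the gain `V − 2N ≥ 0`
(`kineticLatticeBEC_false_without_halfFilling`); the anchor is `N = 0` (`f(0) ≥ 0`), no RP; `-- Targets`: none.
-/

noncomputable section

namespace Summit.AtomisticToContinuum.BoseEinsteinCondensation.Cruxes.KineticLatticeBEC.SectorLadder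

open scoped BigOperators Matrix ComplexOrder
open Literature.MathematicalPhysics.QuantumLattice Literature.Probability.LatticeModels Matrix Complex
open Summit.AtomisticToContinuum.BoseEinsteinCondensation.Theses.BECStronglyRayleigh

/-! ### Stub A-high (hard, lead): the insertion-infidelity bound on the rungs `N ≥ 2` -/

/-- **Stub A-high — `InsertionInfidelityBound`, rungs `N ≥ 2` (the hard stub).** There is `K` such that
for every `L ≥ 2`, every `N ≥ 2` with `2(N+1) ≤ L³` and all nonzero entrywise-nonnegative ground vectors
`ψ₀`, `ψ₁` of the sectors `N − L³/2`, `N + 1 − L³/2` of `xyTorus 3 L 1`: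
`(1 − K/√(L³(N+1))) · ‖Ŝ⁺ψ₀‖² · ‖ψ₁‖² ≤ |⟨ψ₁, Ŝ⁺ψ₀⟩|²`, i.e. the insertion infidelity
`δ_N = 1 − |⟨ψ₁,Ŝ⁺ψ₀⟩|²/(‖Ŝ⁺ψ₀‖²‖ψ₁‖²)` is at most `K/√(L³(N+1))` (card profile `δ_N ≍ √(νa³)/N`).
[folklore] -/
theorem stub_insertionInfidelityHigh :
    ∃ K : ℝ, ∀ (L : ℕ) [NeZero L], 2 ≤ L → ∀ N : ℕ, 2 ≤ N → 2 * (N + 1) ≤ L ^ 3 →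
      ∀ ψ₀ ψ₁ : TensorIndex (TorusSite 3 L) 2 → ℂ,
        ψ₀ ≠ 0 → (∀ σ, 0 ≤ (ψ₀ σ).re ∧ (ψ₀ σ).im = 0) →
        ψ₀ ∈ spinZSector 1 ((N : ℝ) - (L : ℝ) ^ 3 / 2) →
        (xyTorus 3 L 1) *ᵥ ψ₀ =
          ((lowestEnergyInSector 1 (xyTorus 3 L 1) ((N : ℝ) - (L : ℝ) ^ 3 / 2) : ℝ) : ℂ) • ψ₀ →
        ψ₁ ≠ 0 → (∀ σ, 0 ≤ (ψ₁ σ).re ∧ (ψ₁ σ).im = 0) →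
        ψ₁ ∈ spinZSector 1 (((N + 1 : ℕ) : ℝ) - (L : ℝ) ^ 3 / 2) →
        (xyTorus 3 L 1) *ᵥ ψ₁ =
          ((lowestEnergyInSector 1 (xyTorus 3 L 1) (((N + 1 : ℕ) : ℝ) - (L : ℝ) ^ 3 / 2) : ℝ) : ℂ) •
            ψ₁ →
        (1 - K / Real.sqrt ((L : ℝ) ^ 3 * ((N : ℝ) + 1))) *
            (star ((totalSpin 1 0 + I • totalSpin 1 1 : Op (TorusSite 3 L) 2) *ᵥ ψ₀) ⬝ᵥ
              ((totalSpin 1 0 + I • totalSpin 1 1 : Op (TorusSite 3 L) 2) *ᵥ ψ₀)).re *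
            (star ψ₁ ⬝ᵥ ψ₁).re ≤
          ‖star ψ₁ ⬝ᵥ ((totalSpin 1 0 + I • totalSpin 1 1 : Op (TorusSite 3 L) 2) *ᵥ ψ₀)‖ ^ 2 := by
  sorry

/-! ### Stubs B, C, D, E, F, A-low — LANDED (imported):
* `stub_twoBodyL2Flat` (Stub F) — Theorems/BECStronglyRayleighKineticLatticeBECTwoBodyL2Flat.lean;
* `stub_insertionInfidelityLow` (Stub A-low) — Theorems/BECStronglyRayleighKineticLatticeBECInsertionInfidelityLow.lean;
* `stub_ladderStep` — Theorems/BECStronglyRayleighKineticLatticeBECLadderStep.lean (p87720, accepted);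
* `stub_productLowerBound` — Theorems/BECStronglyRayleighKineticLatticeBECProductLowerBound.lean (p88640, accepted);
* `stub_transfer` — Theorems/BECStronglyRayleighKineticLatticeBECTransfer.lean (p89477, accepted);
* `stub_reduction` (Stub E, the line's conditional theorem: uniformly positive fidelity budget ⟹ crux) —
  Theorems/BECStronglyRayleighKineticLatticeBECReduction.lean (p90479, accepted). -/

/-! ### Composition -/

/-- **Stub A reassembled**: the insertion-fidelity inequality on ALL rungs `2(N+1) ≤ L³` with one constant
`K = max K₁ K₂` (rungs `N ≤ 1` from Stubs F + A-low with `K₁`, rungs `N ≥ 2` from Stub A-high with `K₂`;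
the inequality is monotone in `K` because both norms are nonnegative). [folklore] -/
theorem insertionInfidelityBound_all :
    ∃ K : ℝ, ∀ (L : ℕ) [NeZero L], 2 ≤ L → ∀ N : ℕ, 2 * (N + 1) ≤ L ^ 3 →
      ∀ ψ₀ ψ₁ : TensorIndex (TorusSite 3 L) 2 → ℂ,
        ψ₀ ≠ 0 → (∀ σ, 0 ≤ (ψ₀ σ).re ∧ (ψ₀ σ).im = 0) →
        ψ₀ ∈ spinZSector 1 ((N : ℝ) - (L : ℝ) ^ 3 / 2) →
        (xyTorus 3 L 1) *ᵥ ψ₀ =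
          ((lowestEnergyInSector 1 (xyTorus 3 L 1) ((N : ℝ) - (L : ℝ) ^ 3 / 2) : ℝ) : ℂ) • ψ₀ →
        ψ₁ ≠ 0 → (∀ σ, 0 ≤ (ψ₁ σ).re ∧ (ψ₁ σ).im = 0) →
        ψ₁ ∈ spinZSector 1 (((N + 1 : ℕ) : ℝ) - (L : ℝ) ^ 3 / 2) →
        (xyTorus 3 L 1) *ᵥ ψ₁ =
          ((lowestEnergyInSector 1 (xyTorus 3 L 1) (((N + 1 : ℕ) : ℝ) - (L : ℝ) ^ 3 / 2) : ℝ) : ℂ) •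
            ψ₁ →
        (1 - K / Real.sqrt ((L : ℝ) ^ 3 * ((N : ℝ) + 1))) *
            (star ((totalSpin 1 0 + I • totalSpin 1 1 : Op (TorusSite 3 L) 2) *ᵥ ψ₀) ⬝ᵥ
              ((totalSpin 1 0 + I • totalSpin 1 1 : Op (TorusSite 3 L) 2) *ᵥ ψ₀)).re *
            (star ψ₁ ⬝ᵥ ψ₁).re ≤
          ‖star ψ₁ ⬝ᵥ ((totalSpin 1 0 + I • totalSpin 1 1 : Op (TorusSite 3 L) 2) *ᵥ ψ₀)‖ ^ 2 := by
  obtain ⟨K₁, hK₁⟩ := stub_insertionInfidelityLow stub_twoBodyL2Flat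
  obtain ⟨K₂, hK₂⟩ := stub_insertionInfidelityHigh
  refine ⟨max K₁ K₂, ?_⟩
  intro L _ hL2 N h2N1 ψ₀ ψ₁ hψ₀0 hψ₀nn hψ₀sec hHψ₀ hψ₁0 hψ₁nn hψ₁sec hHψ₁
  have hs : 0 < Real.sqrt ((L : ℝ) ^ 3 * ((N : ℝ) + 1)) := by
    have hL0 : (0 : ℝ) < (L : ℝ) := by exact_mod_cast (lt_of_lt_of_le (by norm_num) hL2)
    exact Real.sqrt_pos.mpr (by positivity)
  -- monotonicity of the rung inequality in `K`
  have hmono : ∀ K : ℝ, K ≤ max K₁ K₂ →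
        (1 - K / Real.sqrt ((L : ℝ) ^ 3 * ((N : ℝ) + 1))) *
            (star ((totalSpin 1 0 + I • totalSpin 1 1 : Op (TorusSite 3 L) 2) *ᵥ ψ₀) ⬝ᵥ
              ((totalSpin 1 0 + I • totalSpin 1 1 : Op (TorusSite 3 L) 2) *ᵥ ψ₀)).re *
            (star ψ₁ ⬝ᵥ ψ₁).re ≤
          ‖star ψ₁ ⬝ᵥ ((totalSpin 1 0 + I • totalSpin 1 1 : Op (TorusSite 3 L) 2) *ᵥ ψ₀)‖ ^ 2 →
        (1 - max K₁ K₂ / Real.sqrt ((L : ℝ) ^ 3 * ((N : ℝ) + 1))) *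
            (star ((totalSpin 1 0 + I • totalSpin 1 1 : Op (TorusSite 3 L) 2) *ᵥ ψ₀) ⬝ᵥ
              ((totalSpin 1 0 + I • totalSpin 1 1 : Op (TorusSite 3 L) 2) *ᵥ ψ₀)).re *
            (star ψ₁ ⬝ᵥ ψ₁).re ≤
          ‖star ψ₁ ⬝ᵥ ((totalSpin 1 0 + I • totalSpin 1 1 : Op (TorusSite 3 L) 2) *ᵥ ψ₀)‖ ^ 2 := by
    intro K hKK' hA
    have hdd' : 1 - max K₁ K₂ / Real.sqrt ((L : ℝ) ^ 3 * ((N : ℝ) + 1)) ≤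
        1 - K / Real.sqrt ((L : ℝ) ^ 3 * ((N : ℝ) + 1)) := by
      have := div_le_div_of_nonneg_right hKK' hs.le
      linarith
    exact le_trans (mul_le_mul_of_nonneg_right (mul_le_mul_of_nonneg_right hdd'
      (EigenvalueContinuation.re_star_dotProduct_self_nonneg _))
      (EigenvalueContinuation.re_star_dotProduct_self_nonneg _)) hA
  rcases Nat.lt_or_ge N 2 with hN | hN
  · exact hmono K₁ (le_max_left _ _)
      (hK₁ L hL2 N (by omega) h2N1 ψ₀ ψ₁ hψ₀0 hψ₀nn hψ₀sec hHψ₀ hψ₁0 hψ₁nn hψ₁sec hHψ₁)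
  · exact hmono K₂ (le_max_right _ _)
      (hK₂ L hL2 N hN h2N1 ψ₀ ψ₁ hψ₀0 hψ₀nn hψ₀sec hHψ₀ hψ₁0 hψ₁nn hψ₁sec hHψ₁)

/-- **Composition of the line.** Stubs A-high, F, A-low (reassembled into Stub A by `insertionInfidelityBound_all`) with the landed stubs B–E imply the crux `KineticLatticeBEC`,
concluded BY NAME: enlarge `K` to `K' = max K 0`, take `L₁ = max ⌈4K'²⌉ 1` (so `4K'² ≤ L ≤ L³` for
`L ≥ L₁`), put `δ(L,N) = K'/√(L³(N+1))` and `κ = e^{−2√2K'}`: Stub C gives `δ ∈ [0,½]` and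
`κ ≤ Π_{i<N}(1 − δ(L,i))`, Stub A (weakened from `K` to `K'`) gives the fidelity bound, and Stub E concludes.
[folklore] -/
theorem KineticLatticeBEC_of : KineticLatticeBEC := by
  obtain ⟨K, hK⟩ := insertionInfidelityBound_all
  have hK'0 : 0 ≤ max K 0 := le_max_right _ _
  have hKK' : K ≤ max K 0 := le_max_left _ _
  obtain ⟨L₁, hL₁, hL₁1⟩ : ∃ L₁ : ℕ, 4 * (max K 0) ^ 2 ≤ (L₁ : ℝ) ∧ 1 ≤ L₁ :=
    ⟨max ⌈4 * (max K 0) ^ 2⌉₊ 1, le_trans (Nat.le_ceil _) (by exact_mod_cast le_max_left _ _),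
      le_max_right _ _⟩
  -- for `L ≥ L₁`: `0 < L³` and `4K'² ≤ L³`
  have hVL : ∀ L : ℕ, L₁ ≤ L → (0 : ℝ) < (L : ℝ) ^ 3 ∧ 4 * (max K 0) ^ 2 ≤ (L : ℝ) ^ 3 := by
    intro L hL
    have hL1 : (1 : ℝ) ≤ (L : ℝ) := by exact_mod_cast (le_trans hL₁1 hL)
    refine ⟨by positivity, ?_⟩
    calc 4 * (max K 0) ^ 2 ≤ (L₁ : ℝ) := hL₁
      _ ≤ (L : ℝ) := by exact_mod_cast hL
      _ ≤ (L : ℝ) ^ 3 := le_self_pow₀ hL1 (by norm_num)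
  refine stub_reduction (Real.exp (-(2 * Real.sqrt 2 * max K 0))) (Real.exp_pos _)
    (fun L N => max K 0 / Real.sqrt ((L : ℝ) ^ 3 * ((N : ℝ) + 1))) L₁ ?_ ?_ ?_
  · -- Stub C: the factors lie in `[0, 1]`
    intro L N hL h2N1
    obtain ⟨hV0, hKV⟩ := hVL L hL
    have h2N1' : 2 * ((N + 1 : ℕ) : ℝ) ≤ (L : ℝ) ^ 3 := by exact_mod_cast h2N1
    obtain ⟨hfac, -⟩ := stub_productLowerBound (max K 0) ((L : ℝ) ^ 3) hK'0 hV0 hKV (N + 1) h2N1'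
    exact hfac N (Finset.mem_range.mpr (Nat.lt_succ_self N))
  · -- Stub C: the budget is uniformly positive
    intro L N hL h2N
    obtain ⟨hV0, hKV⟩ := hVL L hL
    have h2N' : 2 * (N : ℝ) ≤ (L : ℝ) ^ 3 := by exact_mod_cast h2N
    exact (stub_productLowerBound (max K 0) ((L : ℝ) ^ 3) hK'0 hV0 hKV N h2N').2
  · -- Stub A, weakened from `K` to `K' = max K 0`
    intro L _ _ hL2 N h2N1 ψ₀ ψ₁ hψ₀0 hψ₀nn hψ₀sec hHψ₀ hψ₁0 hψ₁nn hψ₁sec hHψ₁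
    have hA := hK L hL2 N h2N1 ψ₀ ψ₁ hψ₀0 hψ₀nn hψ₀sec hHψ₀ hψ₁0 hψ₁nn hψ₁sec hHψ₁
    have hs : 0 < Real.sqrt ((L : ℝ) ^ 3 * ((N : ℝ) + 1)) := by
      have hL0 : (0 : ℝ) < (L : ℝ) := by exact_mod_cast (lt_of_lt_of_le (by norm_num) hL2)
      exact Real.sqrt_pos.mpr (by positivity)
    have hdd' : 1 - max K 0 / Real.sqrt ((L : ℝ) ^ 3 * ((N : ℝ) + 1)) ≤
        1 - K / Real.sqrt ((L : ℝ) ^ 3 * ((N : ℝ) + 1)) := by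
      have := div_le_div_of_nonneg_right hKK' hs.le
      linarith
    exact le_trans (mul_le_mul_of_nonneg_right (mul_le_mul_of_nonneg_right hdd'
      (EigenvalueContinuation.re_star_dotProduct_self_nonneg _))
      (EigenvalueContinuation.re_star_dotProduct_self_nonneg _)) hA

end Summit.AtomisticToContinuum.BoseEinsteinCondensation.Cruxes.KineticLatticeBEC.SectorLadder
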